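/-
Origin: expansion seat `planner-pub-hodgecm-mc-axioms-1-g14-0`, handover #W217 2026-08-20T15:53:55Z md5 81ec08de6a54 (PKG a1a0aeb97a56 → 81ec08de6a54; 216 l.; MECHANICAL (iib-R) rewrite v3.1 of the PKG file as it stands (10 token edits; rules R1x1+RX[h₂]x9)) (`HOME/mc/pub-hodgecm-mc-axioms-1-g14/revendor/kit-r55/stage55/HodgeCM/Model/Binders/Gen12TorusPeriodW.lean`, md5 81ec08de6a54, 216 lines);
landed by the gen-22 packager (p-g22) in gate run 55 REPLACES the earlier landed copy of `HodgeCM/Model/Binders/Gen12TorusPeriodW.lean` (seat copy carried the packager Origin header of an earlier run (stripped)).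
-/
/-
Origin: speedrun cell pub-hodgecm, MODEL-CONSTRUCTION sub-cell, unit pub-hodgecm-mc-binder-1-g6 (BINDER PROVER, gen 6; node
B2-meet, BINDER-OWNERS row 14 (J-seesaw) preparation), seat prover-pub-hodgecm-mc-binder-1-g6-0, 2026-08-19.
Target in PKG: HodgeCM/Model/Binders/Gen12TorusPeriodW.lean (NEW additive leaf; imports `Model/Binders/Gen12TorusCurrency` (kit #3);
nothing landed imports it).  KERNEL ONLY: 0 records, nothing cited, MODEL-N 0.
-/
import Summits.HodgeConjecture.HodgeCM.Model.Binders.Gen12TorusCurrency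

/-!
# The (12) torus period of the W-block on ALL of `𝒮(𝔸)` (not only on `𝒮^κ`)

The END STATE's generator `ϑ₁₂(χ, Φ)` is defined for `Φ ∈ 𝒮^κ = W.SK` only (the kernel model's index type).  The see-saw identity
(J-seesaw) produces, for a wedge of two theta one-forms, a DIFFERENCE of two torus periods of PRODUCT test functions
`τ(φ₀⁰, φ₁¹) − τ(φ₀¹, φ₁⁰)`, of which only the difference lies in `𝒮^κ` (PerL v5 l. 341, (eq:Qaut) l. 249).  This file therefore
defines the (12) torus period of the W-block `W : WmInput V D` for EVERY Schwartz–Bruhat function `Ψ`,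

  `torusPeriodW W χ Ψ x := ∫_{[U(W₁)]×[U(W₂)]} χ(u₁u₂) · Θ(W.ρ(eV x⁻¹, eW (jT₁₂ (u₁,u₂))) Ψ) d(du₁ du₂)`,

LINEAR in `Ψ` (`torusPeriodW_add/_smul`), from the descended kernel `thetaWQ W Ψ x ∈ C([T], ℂ)` (the function
`t ↦ Θ(W.ρ(eV x⁻¹, eW (jT₁₂ t)) Ψ)` is continuous by Weil's majorants `W.hρ` and `T(L₀)`-invariant by `W.hrat`/`W.hΓW`), and proves the
JUNCTION with kit #3: at the pin and for `Φ ∈ 𝒮^κ`, **`(pinR12 …).kt.ϑc χ Φ (xΓ_U) = ν_T(𝓕_T) • torusPeriodW (W V c) χ Φ x`**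
(`t12_ϑc_mk_eq_smul_torusPeriodW`, regime `hW : IsAnisotropic L c.D.gramW`).  With this, (J-seesaw) of `Binders/Gen12Junctions` reduces to
the tensor decomposition of `Θ(W.ρ(·, eW (jT₁₂ ·)) (τ φ₁ φ₂))` along the torus ((S-restr) `P_eq_restrict`, period-1 lineage) and the
`𝒮^κ`-membership of the wedge test function.  Nothing here is a claim of the manuscripts under adjudication.
-/

set_option autoImplicit false

noncomputable section

open MeasureTheory NumberField
open scoped InnerProductSpace ENNReal

attribute [-instance] Quotient.instMeasurableSpace

namespace HodgeCM.Model

open HodgeCM HodgeCM.Universe HodgeCM.PerL34.Annihilation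
open Literature.NumberTheory.Weil1964
open Literature.NumberTheory.Automorphic (piSchwartzBruhat)

section General

variable {L : CMField} {ι₁ : L →+* ℂ} {V : HermSpace3 L ι₁} {D : StubTree.SeesawDatum L} (W : WmInput V D)

local notation3 "L⁺" => maximalRealSubfield (L : Type)

/-! ## 1. The W-block's theta value along the (12) torus -/

/-- `θ^W_Ψ(x, t) := Θ(W.ρ(eV x⁻¹, eW (jT₁₂ t)) Ψ)` — the W-block's kernel at a point of `U(V)(𝔸)` and a point of the (12) torus
`T(𝔸)`, for EVERY `Ψ ∈ 𝒮(𝔸)` (the kernel-model convention of `wmOf'_θ_mk`). -/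
def thetaW (Ψ : piSchwartzBruhat W.F W.ι) (x : ↥(Adelic.adelicUnitaryGroup L V.Hm)) (t : SeesawTorus L⁺ L) : ℂ :=
  thetaDistLM W.F W.ι ((W.ρ (W.eV x⁻¹, W.eW (D.jT₁₂ t)) : Module.End ℂ (piSchwartzBruhat W.F W.ι)) Ψ)

/-- (Ported verbatim from the HodgeCMPerL package; no docstring in the source.) -/
theorem thetaW_apply (Ψ : piSchwartzBruhat W.F W.ι) (x : ↥(Adelic.adelicUnitaryGroup L V.Hm)) (t : SeesawTorus L⁺ L) :
    thetaW W Ψ x t = thetaDistLM W.F W.ι ((W.ρ (W.eV x⁻¹, W.eW (D.jT₁₂ t)) : Module.End ℂ (piSchwartzBruhat W.F W.ι)) Ψ) :=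
  rfl

/-- (Ported verbatim from the HodgeCMPerL package; no docstring in the source.) -/
theorem thetaW_add (Ψ Ψ' : piSchwartzBruhat W.F W.ι) (x : ↥(Adelic.adelicUnitaryGroup L V.Hm)) (t : SeesawTorus L⁺ L) :
    thetaW W (Ψ + Ψ') x t = thetaW W Ψ x t + thetaW W Ψ' x t := by
  simp only [thetaW_apply, map_add]

/-- (Ported verbatim from the HodgeCMPerL package; no docstring in the source.) -/
theorem thetaW_smul (a : ℂ) (Ψ : piSchwartzBruhat W.F W.ι) (x : ↥(Adelic.adelicUnitaryGroup L V.Hm)) (t : SeesawTorus L⁺ L) :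
    thetaW W (a • Ψ) x t = a * thetaW W Ψ x t := by
  simp only [thetaW_apply, map_smul, smul_eq_mul]

/-- continuity in the torus variable (Weil's majorants `W.hρ` + continuity of `eW`, `jT₁₂`). -/
theorem continuous_thetaW (Ψ : piSchwartzBruhat W.F W.ι) (x : ↥(Adelic.adelicUnitaryGroup L V.Hm)) :
    Continuous (thetaW W Ψ x) :=
  (W.hρ.continuous_thetaDistLM Ψ).comp (continuous_const.prodMk (W.heW.comp D.jT₁₂.continuous))

/-- `T(L₀)`-invariance: `θ^W_Ψ(x, γ t) = θ^W_Ψ(x, t)` for `γ ∈ T(L₀)` (`ρ(1, eW (jT₁₂ γ))` fixes `Θ`: `W.hrat` + `W.hΓW` + `jT₁₂(T(L₀)) ⊆ U(W)(L₀)`). -/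
theorem thetaW_rat_mul (Ψ : piSchwartzBruhat W.F W.ι) (x : ↥(Adelic.adelicUnitaryGroup L V.Hm)) {γ : SeesawTorus L⁺ L}
    (hγ : γ ∈ SeesawTorus.rat L⁺ L) (t : SeesawTorus L⁺ L) : thetaW W Ψ x (γ * t) = thetaW W Ψ x t := by
  have hΓ : W.eW (D.jT₁₂ γ) ∈ W.Γ := W.hΓW _ (D.rat_le_comap_jT₁₂ hγ)
  have hstab := (mem_thetaStabilizer_iff _).1 (W.hrat 1 W.ΓU.one_mem _ hΓ)
  rw [thetaW_apply, thetaW_apply, map_mul, map_mul]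
  have hsplit : ((W.eV x⁻¹, W.eW (D.jT₁₂ γ) * W.eW (D.jT₁₂ t)) : W.GU × W.G) =
      ((1 : W.GU), W.eW (D.jT₁₂ γ)) * (W.eV x⁻¹, W.eW (D.jT₁₂ t)) := by
    rw [Prod.mk_mul_mk, one_mul]
  rw [hsplit, map_mul, Units.val_mul, Module.End.mul_apply]
  exact hstab _

/-- `θ^W_Ψ(x, ·)` is constant on `T(L₀)`-cosets. -/
theorem thetaW_eq_of_mk_eq (Ψ : piSchwartzBruhat W.F W.ι) (x : ↥(Adelic.adelicUnitaryGroup L V.Hm)) {t t' : SeesawTorus L⁺ L}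
    (h : (QuotientGroup.mk t : SeesawTorus L⁺ L ⧸ SeesawTorus.rat L⁺ L) = QuotientGroup.mk t') :
    thetaW W Ψ x t = thetaW W Ψ x t' := by
  have hmem : t⁻¹ * t' ∈ SeesawTorus.rat L⁺ L := QuotientGroup.eq.mp h
  have ht' : t' = (t⁻¹ * t') * t := by rw [mul_comm, ← mul_assoc, mul_inv_cancel, one_mul]
  rw [ht', thetaW_rat_mul W Ψ x hmem]

/-- **The descended kernel** `θ^W_Ψ(x, ·) ∈ C([T], ℂ)`. -/
def thetaWQ (Ψ : piSchwartzBruhat W.F W.ι) (x : ↥(Adelic.adelicUnitaryGroup L V.Hm)) :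
    C(SeesawTorus L⁺ L ⧸ SeesawTorus.rat L⁺ L, ℂ) where
  toFun := Quotient.lift (thetaW W Ψ x) fun _ _ hab => thetaW_eq_of_mk_eq W Ψ x (Quotient.sound hab)
  continuous_toFun := (continuous_thetaW W Ψ x).quotient_lift _

/-- (Ported verbatim from the HodgeCMPerL package; no docstring in the source.) -/
@[simp] theorem thetaWQ_mk (Ψ : piSchwartzBruhat W.F W.ι) (x : ↥(Adelic.adelicUnitaryGroup L V.Hm)) (t : SeesawTorus L⁺ L) :
    thetaWQ W Ψ x (QuotientGroup.mk t) = thetaW W Ψ x t := rfl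

/-- (Ported verbatim from the HodgeCMPerL package; no docstring in the source.) -/
theorem thetaWQ_add (Ψ Ψ' : piSchwartzBruhat W.F W.ι) (x : ↥(Adelic.adelicUnitaryGroup L V.Hm)) :
    thetaWQ W (Ψ + Ψ') x = thetaWQ W Ψ x + thetaWQ W Ψ' x := by
  ext q
  induction q using QuotientGroup.induction_on with
  | H t => exact thetaW_add W Ψ Ψ' x t

/-- (Ported verbatim from the HodgeCMPerL package; no docstring in the source.) -/
theorem thetaWQ_smul (a : ℂ) (Ψ : piSchwartzBruhat W.F W.ι) (x : ↥(Adelic.adelicUnitaryGroup L V.Hm)) :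
    thetaWQ W (a • Ψ) x = a • thetaWQ W Ψ x := by
  ext q
  induction q using QuotientGroup.induction_on with
  | H t => exact thetaW_smul W a Ψ x t

/-! ## 2. The torus period of the W-block, for every `Ψ ∈ 𝒮(𝔸)` -/

/-- **`torusPeriodW W χ Ψ x := ∫_{[U(W₁)]×[U(W₂)]} χ(u₁u₂) · θ^W_Ψ(x, u₁u₂) d(du₁ du₂)`** — the (12) torus period against the character
`χ` of `[T]`, read over the two compact line quotients (PerL (eq:seesaw) currency). -/
def torusPeriodW (χ : PontryaginDual (SeesawTorus L⁺ L ⧸ SeesawTorus.rat L⁺ L)) (Ψ : piSchwartzBruhat W.F W.ι)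
    (x : ↥(Adelic.adelicUnitaryGroup L V.Hm)) : ℂ :=
  ∫ p : (relNormOneIdeles L⁺ L ⧸ relNormOneRat L⁺ L) × (relNormOneIdeles L⁺ L ⧸ relNormOneRat L⁺ L),
    dualChar χ (SeesawTorus.quotInl L⁺ L p.1 * SeesawTorus.quotInr L⁺ L p.2) *
      thetaWQ W Ψ x (SeesawTorus.quotInl L⁺ L p.1 * SeesawTorus.quotInr L⁺ L p.2)
    ∂((probHaarRelNormOneQuot L⁺ L).prod (probHaarRelNormOneQuot L⁺ L))

/-- the map `(u₁, u₂) ↦ u₁u₂ ∈ [T]` is continuous -/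
theorem continuous_quotInl_mul_quotInr :
    Continuous fun p : (relNormOneIdeles L⁺ L ⧸ relNormOneRat L⁺ L) × (relNormOneIdeles L⁺ L ⧸ relNormOneRat L⁺ L) =>
      SeesawTorus.quotInl L⁺ L p.1 * SeesawTorus.quotInr L⁺ L p.2 :=
  ((SeesawTorus.continuous_quotInl L⁺ L).comp continuous_fst).mul ((SeesawTorus.continuous_quotInr L⁺ L).comp continuous_snd)

/-- the integrand of `torusPeriodW` is continuous, hence integrable on the compact `[U(W₁)] × [U(W₂)]` -/
theorem integrable_torusPeriodW_integrand (χ : PontryaginDual (SeesawTorus L⁺ L ⧸ SeesawTorus.rat L⁺ L))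
    (Ψ : piSchwartzBruhat W.F W.ι) (x : ↥(Adelic.adelicUnitaryGroup L V.Hm)) :
    Integrable (fun p : (relNormOneIdeles L⁺ L ⧸ relNormOneRat L⁺ L) × (relNormOneIdeles L⁺ L ⧸ relNormOneRat L⁺ L) =>
      dualChar χ (SeesawTorus.quotInl L⁺ L p.1 * SeesawTorus.quotInr L⁺ L p.2) *
        thetaWQ W Ψ x (SeesawTorus.quotInl L⁺ L p.1 * SeesawTorus.quotInr L⁺ L p.2))
      ((probHaarRelNormOneQuot L⁺ L).prod (probHaarRelNormOneQuot L⁺ L)) := by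
  refine Continuous.integrable_of_hasCompactSupport ?_ (HasCompactSupport.of_compactSpace _)
  exact ((continuous_dualChar χ).comp (continuous_quotInl_mul_quotInr (L := L))).mul
    ((thetaWQ W Ψ x).continuous.comp (continuous_quotInl_mul_quotInr (L := L)))

/-- (Ported verbatim from the HodgeCMPerL package; no docstring in the source.) -/
theorem torusPeriodW_add (χ : PontryaginDual (SeesawTorus L⁺ L ⧸ SeesawTorus.rat L⁺ L)) (Ψ Ψ' : piSchwartzBruhat W.F W.ι)
    (x : ↥(Adelic.adelicUnitaryGroup L V.Hm)) :
    torusPeriodW W χ (Ψ + Ψ') x = torusPeriodW W χ Ψ x + torusPeriodW W χ Ψ' x := by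
  unfold torusPeriodW
  rw [← integral_add (integrable_torusPeriodW_integrand W χ Ψ x) (integrable_torusPeriodW_integrand W χ Ψ' x)]
  refine integral_congr_ae (Filter.Eventually.of_forall fun p => ?_)
  simp only [thetaWQ_add, ContinuousMap.add_apply, mul_add]

/-- (Ported verbatim from the HodgeCMPerL package; no docstring in the source.) -/
theorem torusPeriodW_smul (χ : PontryaginDual (SeesawTorus L⁺ L ⧸ SeesawTorus.rat L⁺ L)) (a : ℂ)
    (Ψ : piSchwartzBruhat W.F W.ι) (x : ↥(Adelic.adelicUnitaryGroup L V.Hm)) :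
    torusPeriodW W χ (a • Ψ) x = a * torusPeriodW W χ Ψ x := by
  unfold torusPeriodW
  rw [← integral_const_mul]
  refine integral_congr_ae (Filter.Eventually.of_forall fun p => ?_)
  simp only [thetaWQ_smul, ContinuousMap.smul_apply, smul_eq_mul]
  ring

/-- (Ported verbatim from the HodgeCMPerL package; no docstring in the source.) -/
theorem torusPeriodW_sub (χ : PontryaginDual (SeesawTorus L⁺ L ⧸ SeesawTorus.rat L⁺ L)) (Ψ Ψ' : piSchwartzBruhat W.F W.ι)
    (x : ↥(Adelic.adelicUnitaryGroup L V.Hm)) :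
    torusPeriodW W χ (Ψ - Ψ') x = torusPeriodW W χ Ψ x - torusPeriodW W χ Ψ' x := by
  rw [sub_eq_add_neg, torusPeriodW_add, ← neg_one_smul ℂ Ψ', torusPeriodW_smul]
  ring

end General

/-! ## 3. Junction with the END STATE: `ϑc χ Φ (xΓ_U) = ν_T(𝓕_T) • torusPeriodW (W V c) χ Φ x` for `Φ ∈ 𝒮^κ` -/

section Pin

open Literature.AlgebraicGeometry.HodgeTheory
open Literature.NumberTheory.Automorphic.PicardCM
open Literature.NumberTheory.Transcendental (Arapura2012_Cor_15_4_6)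

variable (hHD : exists_isReal_hodgeModel) (hI : hodgePQ_independent_of_hodgeModel)
  (h₁ : BallQuotientUniformised)  (h₃ : CMAbelianVarietyRealised)
variable (h : Bool) (hA : Arapura2012_Cor_15_4_6)
  (W : ∀ {L : CMField} {ι₁ : L →+* ℂ} (V : HermSpace3 L ι₁) (c : SeesawCtx L), WmInput V c.D)
  (S : ∀ {L : CMField} {ι₁ : L →+* ℂ} (V : HermSpace3 L ι₁) (c : SeesawCtx L), ThetaAdelicSide V c)
  (μ : ∀ {L : CMField}, SeesawCtx L → Fin 4 → InfinitePlace L → ℤ)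
variable {L : CMField} {ι₁ : L →+* ℂ} (V : HermSpace3 L ι₁) (c : SeesawCtx L)

local notation3 "L⁺" => maximalRealSubfield (L : Type)

/-- The (12) period integrand of the END STATE IS `χ · θ^W` descended (regime of `U(W)`). -/
theorem periodIntegrand₁₂_eq_mul_thetaWQ (hW : IsAnisotropic L c.D.gramW)
    (χ : ((pinT hHD hI h₁ h₃ h hA W S μ).t12 V c).X) (Φ : (pinT hHD hI h₁ h₃ h hA W S μ).SK V c)
    (x : ↥(Adelic.regimeSubgroup L V.Hm)) (q : SeesawTorus L⁺ L ⧸ SeesawTorus.rat L⁺ L) :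
    (pinR12 hHD hI h₁ h₃ h hA W S μ V c).periodIntegrand (hΛ₁₂ c) χ Φ (QuotientGroup.mk x) q =
      dualChar χ.1 q * thetaWQ (W V c) Φ.1 (x : ↥(Adelic.adelicUnitaryGroup L V.Hm)) q := by
  induction q using QuotientGroup.induction_on with
  | H t => rw [periodIntegrand₁₂_mk hHD hI h₁ h₃ h hA W S μ V c hW χ Φ x t, thetaWQ_mk, thetaW_apply]

/-- **JUNCTION (12)**: for `Φ ∈ 𝒮^κ` and `χ` a character of the side's archimedean type, the END STATE's torus period at `xΓ_U` is the
W-block's torus period: `ϑc χ Φ (xΓ_U) = ν_T(𝓕_T) • torusPeriodW (W V c) χ Φ x` — so `(T.t12 V c).ϑ χ Φ = toLp (ξ ↦ …)` reads, value by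
value, as a `[U(W₁)] × [U(W₂)]`-period of `Θ(W.ρ(eV x⁻¹, eW (jT₁₂ ·)) Φ)` (PerL (eq:seesaw) currency). -/
theorem t12_ϑc_mk_eq_smul_torusPeriodW (hW : IsAnisotropic L c.D.gramW)
    (χ : ((pinT hHD hI h₁ h₃ h hA W S μ).t12 V c).X) (Φ : (pinT hHD hI h₁ h₃ h hA W S μ).SK V c)
    (x : ↥(Adelic.regimeSubgroup L V.Hm)) :
    (pinR12 hHD hI h₁ h₃ h hA W S μ V c).kt.ϑc χ Φ (QuotientGroup.mk x) =
      (SeesawTorus.haar L⁺ L (SeesawTorus.fundamentalDomain L⁺ L)).toReal •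
        torusPeriodW (W V c) χ.1 Φ.1 (x : ↥(Adelic.adelicUnitaryGroup L V.Hm)) := by
  rw [t12_ϑc_eq_smul_integral_prod hHD hI h₁ h₃ h hA W S μ V c χ Φ (QuotientGroup.mk x)]
  congr 1
  unfold torusPeriodW
  refine integral_congr_ae (Filter.Eventually.of_forall fun p => ?_)
  exact periodIntegrand₁₂_eq_mul_thetaWQ hHD hI h₁ h₃ h hA W S μ V c hW χ Φ x _

end Pin

end HodgeCM.Model

end
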